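import Literature.MathematicalPhysics.QuantumFieldTheory.Balaban1983to89.Node00.Record12Numerics
import Literature.MathematicalPhysics.QuantumFieldTheory.Balaban1983to89.Node00.Record12ResidualsSlots

/-!
# NODE 00 (YM-PLAN Track A) — STAGE 12: THE LIVE SELECTOR OF RECORD and `θ₀` RE-PINNED AT IT (director-ym LINE №114 (α)) —
# `SlotsNondegenerate` at the re-pinned parameter REDUCED, in kernel, to «some live sequence at every positive level» (row P12 proper)

Cell `pub-ymgap`, seat `pub-ymgap-node00-def-K0a` (g2).  [III] = [Balaban1988Convergent], [IV] = [Balaban1989LargeFieldI].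

WHY.  The K0′ witness `θ₀ = theta12OfRecord F N ζ Rz Zt` (`Node00/Record12Numerics`) carries the IDENTITY `p–p′` selector `ppSelIdOfRecord`.  12b's
`Stage12Params.SlotsNondegenerate θ` (Record12 :610) asks the post-𝐑 slot of every sequence IN THE RANGE OF THE SELECTOR to be non-zero; at the identity
selector the range is every sequence, including the ABSENT ones (outside the image of n02-b's index map `σOfRecord`), whose 𝐓-image slot is the zero
density (seat K0b, `slotsTOfRecord_succ_eq_zero_of_forall_ne`, p468965) — LOCATED-R2∕R3: `θ₀.SlotsNondegenerate` is refutable as soon as one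
non-surjectivity witness of `σOfRecord` is typed.  Director-ym LINE №114 RULED (α): RE-PIN the selector of the K0′ witness (the selector is a θ-FIELD —
RESIDUAL DATA, «NO CANONICAL CHOICE on sequences», `LargeFieldTowerOfRecord` :267 — precisely so that the `∃ θ` of K0′ can choose it).

WHAT THE R-STEP DOES WITH A SELECTOR (read off def-R's FILE 7 `RStepRepr218.rstepOfSel_TexpA`, [IV] (0.3) re-indexed): the post-𝐑 slot at `s` is
`T(s) · Σ_{a : sel a = s} ∫⌈_{Z′(a)} t_a ∕ ∫⌈_{Z′(a)} t_s` (`t_a = χ(a)·T(a)` the term, `∫⌈` b01's `fibreIntegral` — a `toReal`, hence EVERY ratio is `≥ 0`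
whatever the signs).  So: a sequence outside `range sel` has post-𝐑 slot `0` (empty sum); the summand `a = s` is `∫⌈t_s ∕ ∫⌈t_s ∈ {0, 1}`; hence AT ANY
SELECTOR a range point `s` with non-zero post-𝐑 slot must be **LIVE** — `∃ V, T(s)(V) ≠ 0 ∧ ∫⌈_{Z′(s)} t_s (V) ≠ 0` — and a live FIXED POINT of the selector
HAS non-zero post-𝐑 slot (the sum is `≥ 1` there).  Sign-free, weight-free finite-sum algebra (§1).

THE LIVE SELECTOR (§2).  `ppSelLiveOfRecord E w`: at level 0 the identity; at level `k + 1` the identity on the LIVE sequences of the pre-𝐑 family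
(the T-step of the post-𝐑 level `k`) and every other sequence — absent (zero weight) or present-but-null — sent to ONE chosen live sequence (identity if
none is live).  Defined by recursion on the level together with its post-𝐑 family `liveSlotsOfRecord` (the slot at level `k + 1` reads the selector at
levels `≤ k + 1`), and PROVED to agree with def-T's families: `slotsOfRecord … (ppSelLiveOfRecord E w) = liveSlotsOfRecord E w` (§2).  Its range at a positive
level is exactly the live set (when non-empty).  CONSEQUENCE (§2 `slotsOfRecord_ppSelLive_succ_nondegenerate_iff`): at the live selector, «every range point
has non-zero post-𝐑 slot at level `k + 1`» ⟺ «if level `k + 1` has sequences at all, SOME sequence is live» — the MINIMAL content, and exactly row P12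
proper (seat K0b: the level-1, `p.K ≥ 1` instance up to the `Z′`-normalisation factor is `exists_slotT_one_ne_zero_of_hasResidualsOfRecord`).
REMARK (the literal (α) of №114, «range = the PRESENT sequences»): by the same algebra `SlotsNondegenerate` at a present-valued selector reads «EVERY present
positive-level sequence is live» (absent sequences contribute zero ratios) — per-label firing of def-R's minimiser, K0b's LOCATED-R2 species; not typed here.

AT STAGE 12 (§3).  `Stage12Params.liveRepin θ := { θ with ppSel := ppSelLiveOfRecord (EOfRecord₁₀ θ…) (wOfRecord₉ θ…) }` — GENERIC in `θ`; the Stage-8 part,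
the histories `gOfRecord₁₀`, the normalisations `EOfRecord₁₀`, the step weights `wOfRecord₉`, `ζ`, `Rz`, `Zt`, `A₁`, `τ9`, the §2 numerics are UNCHANGED (`rfl`):
of the K0′ conjuncts ONLY `Provisos₁₂.base` (the Stage-10 tower clauses, which quantify over the slot families) reads the selector — `Admissible`, `ZtUnity`,
`rzLaws`, `ztLaws`, `ztLocal`, `bg` and K0b's `HasResidualsOfRecord` transport by `rfl`.  **`slotsNondegenerate_liveRepin_iff`**: `θ.liveRepin.SlotsNondegenerate ↔
∀ p k, k + 1 ≤ p.K → Nonempty (sequences of level k+1) → ∃ s, LiveSeq … (slotsTOfRecord … θ.liveRepin.ppSel p _ (k+1)) s` (v1.1: the RHS carries 12b v2.3's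
level guard `k ≤ p.K` — director-ym LINE №118; up to the torus the RHS is a THEOREM from `Provisos₁₀`, `Record12LiveSelectorTorus`).  §4: `theta12LiveOfRecord F N ζ Rz Zt :=
(theta12OfRecord F N ζ Rz Zt).liveRepin` — THE RE-PINNED K0′ WITNESS — with `admissible_…` (hypothesis-free), `hasResidualsOfRecord_…` (`⟨rfl, rfl, rfl⟩` at K0b's
residuals) hence `ztUnity_…`, the `iff`, K0b's level-1 lemma re-keyed, and the K0′ body for `F` at `N = 2` GIVEN `Provisos₁₂` and per-level liveness
(`exists_k0prime_of_theta12Live`, the item's text verbatim; no Theses import).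

HONEST FRAMING.  A DEFINITION of residual data + finite-sum algebra + bookkeeping; `SlotsNondegenerate` is NOT discharged — it is REDUCED to per-level
liveness (row P12, seat K0b); `Provisos₁₂` at the re-pinned θ₀ is NOT claimed; nothing of Bałaban is asserted; counts unmoved (typed 28∕28 · discharged 5∕28);
one finite 𝕋⁴ programme at fixed ε — NOT continuum ∕ OS ∕ mass gap ∕ Clay.  No `sorry`, no `axiom`, no `instance`, no `notation`.
-/

noncomputable section

open MeasureTheory
open scoped BigOperators

namespace Literature.MathematicalPhysics.QuantumFieldTheory.Balaban1983to89.Node00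

open T4Continuum B14.Eq218Concrete B15RopTotal FlowStep FlowStepRuns
open B15.BasicStep (fibreIntegral)

variable (F : T4Family) (N : ℕ) [NeZero N]

/-! ## §1. The R-step algebra at a fixed point of a selector — GENERIC over def-R's `Step.Repr218` (FILE 7's own currency) -/

section RStepAlgebra

variable {P : Params} {j : ℕ}

/- INSTANCE CONVENTION (def-R TS-8 ∕ `ROperationOfRecordForm` §0): the `DecidableEq (PBond P j)` instance the ratios read is an EXPLICIT binder `iP` of
every generic lemma (a local instance inside it), so that consumers instantiate it BY UNIFICATION with def-R's instance-free terms of record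
(`rstepSlot`, `fibOfSeq`) and never by synthesis (the `Classical.propDecidable` ∕ `instDecidableEqPBond` diamond). -/

/-- Every (0.3) normalisation ratio is non-negative — `fibreIntegral` is a `toReal` (def-R `rstepSlot_nonneg`'s observation, isolated).
[cite: Balaban1989LargeFieldI, (0.3) p.176 (bookkeeping)] -/
theorem rratio_nonneg (iP : DecidableEq (PBond P j)) (r : Step.Repr218 P (SU N) j) (fib : r.Adm → Finset (PBond P j)) (a a' : r.Adm)
    (V : GaugeField P j (SU N)) : 0 ≤ rratio r fib a a' V := by
  unfold rratio fibreIntegral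
  exact div_nonneg ENNReal.toReal_nonneg ENNReal.toReal_nonneg

open Classical in
/-- **AT THE IDENTITY SELECTOR the R-stepped slot is the slot times its OWN normalisation ratio**: `(𝐓e^A)′(a′)(V) = (𝐓e^A)(a′)(V) · ∫⌈t_{a′} ∕ ∫⌈t_{a′}`
(the fibre `{a : a = a′}` is the singleton). [cite: Balaban1989LargeFieldI, (0.3) p.176] -/
theorem rstepOfSel_id_TexpA (iP : DecidableEq (PBond P j)) (r : Step.Repr218 P (SU N) j) (fib : r.Adm → Finset (PBond P j)) (a' : r.Adm)
    (V : GaugeField P j (SU N)) : (rstepOfSel r id fib).TexpA a' V = r.TexpA a' V * rratio r fib a' a' V := by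
  rw [rstepOfSel_TexpA]
  have hS : Finset.univ.filter (fun a => id a = a') = {a'} := by
    ext a
    simp only [Finset.mem_filter, Finset.mem_univ, true_and, id_eq, Finset.mem_singleton]
  rw [hS, Finset.sum_singleton]

open Classical in
/-- **THE ALGEBRA, POSITIVE HALF (any (2.18) representation, any selector): at a FIXED POINT `a′` of the selector whose identity-selector R-stepped slot is
non-zero at `V`, the R-stepped slot at the selector is non-zero at `V`** — `(𝐓e^A)′(a′)(V) = (𝐓e^A)(a′)(V) · Σ_{a : sel a = a′} ∫⌈t_a ∕ ∫⌈t_{a′}`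
(`rstepOfSel_TexpA`); the summand `a = a′` is the (non-zero, non-negative) own ratio and every summand is `≥ 0`. [cite: Balaban1989LargeFieldI, (0.3) p.176] -/
theorem rstepOfSel_TexpA_ne_zero_of_sel_self (iP : DecidableEq (PBond P j)) (r : Step.Repr218 P (SU N) j) (sel : r.Adm → r.Adm)
    (fib : r.Adm → Finset (PBond P j)) {a' : r.Adm} (hsel : sel a' = a') {V : GaugeField P j (SU N)} (hlive : (rstepOfSel r id fib).TexpA a' V ≠ 0) :
    (rstepOfSel r sel fib).TexpA a' V ≠ 0 := by
  rw [rstepOfSel_id_TexpA N iP] at hlive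
  obtain ⟨hT, hρ⟩ := mul_ne_zero_iff.mp hlive
  rw [rstepOfSel_TexpA]
  refine mul_ne_zero hT (ne_of_gt ?_)
  calc (0 : ℝ) < rratio r fib a' a' V := lt_of_le_of_ne (rratio_nonneg N iP r fib a' a' V) (Ne.symm hρ)
    _ ≤ ∑ a ∈ Finset.univ.filter (fun a => sel a = a'), rratio r fib a a' V :=
        Finset.single_le_sum (f := fun a => rratio r fib a a' V) (fun a _ => rratio_nonneg N iP r fib a a' V)
          (Finset.mem_filter.mpr ⟨Finset.mem_univ _, hsel⟩)

open Classical in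
/-- **THE ALGEBRA, NEGATIVE HALF (any representation, any selector): a term whose selector-fibre is at most itself and whose identity-selector R-stepped slot
vanishes identically has ZERO R-stepped slot at the selector** (the fibre is `{a′}` or empty). [cite: Balaban1989LargeFieldI, (0.3) p.176] -/
theorem rstepOfSel_TexpA_eq_zero_of_null (iP : DecidableEq (PBond P j)) (r : Step.Repr218 P (SU N) j) (sel : r.Adm → r.Adm)
    (fib : r.Adm → Finset (PBond P j)) {a' : r.Adm} (hfib : ∀ a, sel a = a' → a = a') (hnull : ∀ V, (rstepOfSel r id fib).TexpA a' V = 0)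
    (V : GaugeField P j (SU N)) : (rstepOfSel r sel fib).TexpA a' V = 0 := by
  have h0 := hnull V
  rw [rstepOfSel_id_TexpA N iP] at h0
  rw [rstepOfSel_TexpA]
  by_cases hs : sel a' = a'
  · have hS : Finset.univ.filter (fun a => sel a = a') = {a'} := by
      ext a
      simp only [Finset.mem_filter, Finset.mem_univ, true_and, Finset.mem_singleton]
      exact ⟨hfib a, fun h => by subst h; exact hs⟩
    rw [hS, Finset.sum_singleton]
    exact h0
  · have hS : Finset.univ.filter (fun a => sel a = a') = ∅ := by
      ext a
      simp only [Finset.mem_filter, Finset.mem_univ, true_and, Finset.notMem_empty, iff_false]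
      intro h
      have ha := hfib a h
      subst ha
      exact hs h
    rw [hS, Finset.sum_empty, mul_zero]

end RStepAlgebra

/-! ## §1b. Live sequences of a slot family of record, the live selector of a slot family, and the algebra at it -/

section LiveSlot

variable (ν : Stage7Numerics) (τ : TowerNumerics) {p : B12.RunParams} {g : ℕ → ℝ} {k : ℕ}

/-- **A LIVE SEQUENCE of a level-`k` slot family `f`**: at some configuration the R-stepped slot AT THE IDENTITY SELECTOR — the slot times the (0.3)
normalisation ratio of its own term over its own `Z′`-variables, `f(s)(V) · ∫⌈_{Z′(s)} χ_k(s)·f(s) ∕ ∫⌈_{Z′(s)} χ_k(s)·f(s)` (`rstepOfSel_id_TexpA`) — is non-zero,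
i.e. `f(s)(V) ≠ 0` and `∫⌈_{Z′(s)} t_s (V) ≠ 0`: exactly what a range point of ANY selector needs for a non-zero post-𝐑 slot.  Stated through def-R's
instance-free term `rstepSlot … id` (TS-8). [cite: Balaban1989LargeFieldI, (0.3) p.176; Balaban1988Convergent, (2.18) p.257] -/
def LiveSeq (p : B12.RunParams) (g : ℕ → ℝ) (k : ℕ) (f : TexpASlot F N ν τ.M p g k) (s : SeqOfRecord F ν τ.M g p.K k) : Prop :=
  ∃ V : GaugeField (F.P p.K) k (SU N), rstepSlot F N ν τ p g k id f s V ≠ 0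

open Classical in
/-- **THE LIVE SELECTOR OF A SLOT FAMILY**: the identity on live sequences; every other sequence is sent to one chosen live sequence (and to itself if no
sequence is live).  Residual data in def-R's sense ([IV] p.177 «the actual procedure is more complicated»; `PpSelOfRecord`: no canonical choice).
[cite: Balaban1989LargeFieldI, (0.3) p.176 and p.177] -/
def liveSelOfSlot (p : B12.RunParams) (g : ℕ → ℝ) (k : ℕ) (f : TexpASlot F N ν τ.M p g k) :
    SeqOfRecord F ν τ.M g p.K k → SeqOfRecord F ν τ.M g p.K k := fun s =>
  if LiveSeq F N ν τ p g k f s then s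
  else if h : ∃ s', LiveSeq F N ν τ p g k f s' then Classical.choose h else s

variable {ν τ}

/-- A live sequence is a fixed point of the live selector. [cite: Balaban1989LargeFieldI, (0.3) p.176 (bookkeeping)] -/
theorem liveSelOfSlot_of_live {f : TexpASlot F N ν τ.M p g k} {s : SeqOfRecord F ν τ.M g p.K k} (hs : LiveSeq F N ν τ p g k f s) :
    liveSelOfSlot F N ν τ p g k f s = s := by
  unfold liveSelOfSlot
  rw [if_pos hs]

/-- With no live sequence the live selector is the identity. [cite: Balaban1989LargeFieldI, (0.3) p.176 (bookkeeping)] -/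
theorem liveSelOfSlot_of_none {f : TexpASlot F N ν τ.M p g k} (h : ¬ ∃ s', LiveSeq F N ν τ p g k f s') (s : SeqOfRecord F ν τ.M g p.K k) :
    liveSelOfSlot F N ν τ p g k f s = s := by
  unfold liveSelOfSlot
  rw [if_neg (fun hs => h ⟨s, hs⟩), dif_neg h]

/-- Every value of the live selector is live, as soon as some sequence is live. [cite: Balaban1989LargeFieldI, (0.3) p.176 (bookkeeping)] -/
theorem liveSeq_liveSelOfSlot {f : TexpASlot F N ν τ.M p g k} (h : ∃ s', LiveSeq F N ν τ p g k f s') (s : SeqOfRecord F ν τ.M g p.K k) :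
    LiveSeq F N ν τ p g k f (liveSelOfSlot F N ν τ p g k f s) := by
  unfold liveSelOfSlot
  by_cases hs : LiveSeq F N ν τ p g k f s
  · rw [if_pos hs]; exact hs
  · rw [if_neg hs, dif_pos h]; exact Classical.choose_spec h

/-- **The range of the live selector IS the live set** (when some sequence is live). [cite: Balaban1989LargeFieldI, (0.3) p.176 (bookkeeping)] -/
theorem mem_range_liveSelOfSlot_iff {f : TexpASlot F N ν τ.M p g k} (h : ∃ s', LiveSeq F N ν τ p g k f s') (s : SeqOfRecord F ν τ.M g p.K k) :
    s ∈ Set.range (liveSelOfSlot F N ν τ p g k f) ↔ LiveSeq F N ν τ p g k f s := by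
  constructor
  · rintro ⟨a, rfl⟩
    exact liveSeq_liveSelOfSlot F N h a
  · intro hs
    exact ⟨s, liveSelOfSlot_of_live F N hs⟩

/-- **At a LIVE FIXED POINT of the selector the post-𝐑 slot of record is non-zero** (the generic positive half at def-R's slice; `rstepSlot` IS
`(rstepOfSel (sliceOfRecord …) sel (fibOfSeq …)).TexpA` by `rfl`; the instance binder is instantiated by unification with def-R's term).  ANY selector.
[cite: Balaban1989LargeFieldI, (0.3) p.176] -/
theorem rstepSlot_ne_zero_of_live_of_sel_self (sel : SeqOfRecord F ν τ.M g p.K k → SeqOfRecord F ν τ.M g p.K k) (f : TexpASlot F N ν τ.M p g k)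
    {s : SeqOfRecord F ν τ.M g p.K k} (hsel : sel s = s) {V : GaugeField (F.P p.K) k (SU N)} (hV : rstepSlot F N ν τ p g k id f s V ≠ 0) :
    rstepSlot F N ν τ p g k sel f s V ≠ 0 := by
  unfold rstepSlot at hV ⊢
  exact rstepOfSel_TexpA_ne_zero_of_sel_self N _ (sliceOfRecord F N ν τ.M p g k f) sel (fibOfSeq F ν τ p g k) hsel hV

/-- **A sequence that is NOT live and whose selector-fibre is at most itself has ZERO post-𝐑 slot of record** (the generic negative half at the slice).
[cite: Balaban1989LargeFieldI, (0.3) p.176] -/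
theorem rstepSlot_eq_zero_of_not_live (sel : SeqOfRecord F ν τ.M g p.K k → SeqOfRecord F ν τ.M g p.K k) (f : TexpASlot F N ν τ.M p g k)
    {s : SeqOfRecord F ν τ.M g p.K k} (hfib : ∀ a, sel a = s → a = s) (hdead : ¬ LiveSeq F N ν τ p g k f s)
    (V : GaugeField (F.P p.K) k (SU N)) : rstepSlot F N ν τ p g k sel f s V = 0 := by
  have hnull : ∀ W, rstepSlot F N ν τ p g k id f s W = 0 := fun W => by
    by_contra h
    exact hdead ⟨W, h⟩
  unfold rstepSlot at hnull ⊢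
  exact rstepOfSel_TexpA_eq_zero_of_null N _ (sliceOfRecord F N ν τ.M p g k f) sel (fibOfSeq F ν τ p g k) hfib hnull V

/-- **AT THE LIVE SELECTOR OF `f` ITSELF: every range point has non-zero post-𝐑 slot ⟺ (sequences exist → some sequence is live).**
[cite: Balaban1989LargeFieldI, (0.3) p.176; Balaban1988Convergent, (3.22) p.269] -/
theorem forall_range_liveSel_rstepSlot_ne_zero_iff (f : TexpASlot F N ν τ.M p g k) :
    (∀ s, s ∈ Set.range (liveSelOfSlot F N ν τ p g k f) → rstepSlot F N ν τ p g k (liveSelOfSlot F N ν τ p g k f) f s ≠ 0) ↔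
      (Nonempty (SeqOfRecord F ν τ.M g p.K k) → ∃ s, LiveSeq F N ν τ p g k f s) := by
  constructor
  · intro h hne
    obtain ⟨s₀⟩ := hne
    by_contra hnone
    have hid : ∀ s, liveSelOfSlot F N ν τ p g k f s = s := liveSelOfSlot_of_none F N hnone
    have hmem : s₀ ∈ Set.range (liveSelOfSlot F N ν τ p g k f) := ⟨s₀, hid s₀⟩
    have hzero : rstepSlot F N ν τ p g k (liveSelOfSlot F N ν τ p g k f) f s₀ = 0 :=
      funext fun V => rstepSlot_eq_zero_of_not_live F N _ f (fun a ha => (hid a).symm.trans ha) (fun hs => hnone ⟨s₀, hs⟩) V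
    exact h s₀ hmem hzero
  · intro h s hs h0
    have hex : ∃ s', LiveSeq F N ν τ p g k f s' := h ⟨s⟩
    have hlive : LiveSeq F N ν τ p g k f s := (mem_range_liveSelOfSlot_iff F N hex s).mp hs
    obtain ⟨V, hV⟩ := hlive
    have h0V : rstepSlot F N ν τ p g k (liveSelOfSlot F N ν τ p g k f) f s V = 0 := by
      rw [h0]; rfl
    exact rstepSlot_ne_zero_of_live_of_sel_self F N _ f (liveSelOfSlot_of_live F N ⟨V, hV⟩) hV h0V

end LiveSlot

/-! ## §2. The live selector OF RECORD (recursion on the level) and its agreement with def-T's slot families -/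

section LiveRecord

variable (ν : Stage7Numerics) (τ : TowerNumerics)

/-- **THE POST-𝐑 SLOT FAMILY UNDER THE LIVE SELECTOR**, by recursion on the level: level 0 = `ρ₀` on every length-0 sequence; level `k + 1` = the R-step, AT
THE LIVE SELECTOR OF THE PRE-𝐑 FAMILY, of the T-step (†) of level `k`. [cite: Balaban1988Convergent, (2.18) p.257, (3.24) p.270; Balaban1989LargeFieldI, (0.3) p.176] -/
def liveSlotsOfRecord (E : B12.RunParams → ℝ) (w : StepWeightsOfRecord F N ν τ.M) (p : B12.RunParams) (g : ℕ → ℝ) :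
    (k : ℕ) → TexpASlot F N ν τ.M p g k
  | 0 => fun _ => rhoZeroOfRecord F N p.K (g 0) (E p)
  | k + 1 =>
    rstepSlot F N ν τ p g (k + 1)
      (liveSelOfSlot F N ν τ p g (k + 1) (tstepOfRecord F N ν τ.M w p g k (liveSlotsOfRecord E w p g k)))
      (tstepOfRecord F N ν τ.M w p g k (liveSlotsOfRecord E w p g k))

/-- **THE LIVE SELECTOR OF RECORD** (`PpSelOfRecord`): level 0 the identity (every length-0 sequence carries `ρ₀ > 0`); level `k + 1` the live selector of the
pre-𝐑 family of level `k + 1` = the T-step of the live post-𝐑 family of level `k`. [cite: Balaban1989LargeFieldI, (0.3) p.176 and p.177; Balaban1988Convergent, (3.22)–(3.24) pp.269–270] -/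
def ppSelLiveOfRecord (E : B12.RunParams → ℝ) (w : StepWeightsOfRecord F N ν τ.M) : PpSelOfRecord F ν τ.M := fun p g k =>
  match k with
  | 0 => id
  | k + 1 => liveSelOfSlot F N ν τ p g (k + 1) (tstepOfRecord F N ν τ.M w p g k (liveSlotsOfRecord F N ν τ E w p g k))

/-- Level 0 of the live selector is the identity (`rfl`). [cite: Balaban1989LargeFieldI, (0.3) p.176 (bookkeeping)] -/
theorem ppSelLiveOfRecord_zero (E : B12.RunParams → ℝ) (w : StepWeightsOfRecord F N ν τ.M) (p : B12.RunParams) (g : ℕ → ℝ) :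
    ppSelLiveOfRecord F N ν τ E w p g 0 = id := rfl

/-- Level `k + 1` of the live selector (`rfl`). [cite: Balaban1989LargeFieldI, (0.3) p.176 (bookkeeping)] -/
theorem ppSelLiveOfRecord_succ (E : B12.RunParams → ℝ) (w : StepWeightsOfRecord F N ν τ.M) (p : B12.RunParams) (g : ℕ → ℝ) (k : ℕ) :
    ppSelLiveOfRecord F N ν τ E w p g (k + 1) =
      liveSelOfSlot F N ν τ p g (k + 1) (tstepOfRecord F N ν τ.M w p g k (liveSlotsOfRecord F N ν τ E w p g k)) := rfl

/-- **AGREEMENT: def-T's post-𝐑 slot family AT THE LIVE SELECTOR IS the live family** (induction on the level through `slotsOfRecord_succ` ∕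
`slotsTOfRecord_succ`). [cite: Balaban1988Convergent, (2.18) p.257, (3.24) p.270; Balaban1989LargeFieldI, (0.3) p.176 (bookkeeping)] -/
theorem slotsOfRecord_ppSelLive (E : B12.RunParams → ℝ) (w : StepWeightsOfRecord F N ν τ.M) (p : B12.RunParams) (g : ℕ → ℝ) :
    ∀ k, slotsOfRecord F N ν τ E w (ppSelLiveOfRecord F N ν τ E w) p g k = liveSlotsOfRecord F N ν τ E w p g k
  | 0 => rfl
  | k + 1 => by
    rw [slotsOfRecord_succ, slotsTOfRecord_succ, slotsOfRecord_ppSelLive E w p g k]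
    rfl

/-- … hence def-T's PRE-𝐑 family at the live selector, level `k + 1`, is the T-step of the live family of level `k`.
[cite: Balaban1988Convergent, (3.24)–(3.25) p.270 (bookkeeping)] -/
theorem slotsTOfRecord_ppSelLive_succ (E : B12.RunParams → ℝ) (w : StepWeightsOfRecord F N ν τ.M) (p : B12.RunParams) (g : ℕ → ℝ) (k : ℕ) :
    slotsTOfRecord F N ν τ E w (ppSelLiveOfRecord F N ν τ E w) p g (k + 1) =
      tstepOfRecord F N ν τ.M w p g k (liveSlotsOfRecord F N ν τ E w p g k) := by
  rw [slotsTOfRecord_succ, slotsOfRecord_ppSelLive]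

/-- … and the live selector of record at level `k + 1` IS the live selector of def-T's pre-𝐑 family there.
[cite: Balaban1989LargeFieldI, (0.3) p.176 (bookkeeping)] -/
theorem ppSelLiveOfRecord_succ_eq (E : B12.RunParams → ℝ) (w : StepWeightsOfRecord F N ν τ.M) (p : B12.RunParams) (g : ℕ → ℝ) (k : ℕ) :
    ppSelLiveOfRecord F N ν τ E w p g (k + 1) =
      liveSelOfSlot F N ν τ p g (k + 1) (slotsTOfRecord F N ν τ E w (ppSelLiveOfRecord F N ν τ E w) p g (k + 1)) := by
  rw [slotsTOfRecord_ppSelLive_succ]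
  rfl

/-- … and the post-𝐑 family at level `k + 1` IS the R-step, at that live selector, of the pre-𝐑 family.
[cite: Balaban1989LargeFieldI, (0.3) p.176 (bookkeeping)] -/
theorem slotsOfRecord_ppSelLive_succ_eq (E : B12.RunParams → ℝ) (w : StepWeightsOfRecord F N ν τ.M) (p : B12.RunParams) (g : ℕ → ℝ) (k : ℕ) :
    slotsOfRecord F N ν τ E w (ppSelLiveOfRecord F N ν τ E w) p g (k + 1) =
      rstepSlot F N ν τ p g (k + 1)
        (liveSelOfSlot F N ν τ p g (k + 1) (slotsTOfRecord F N ν τ E w (ppSelLiveOfRecord F N ν τ E w) p g (k + 1)))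
        (slotsTOfRecord F N ν τ E w (ppSelLiveOfRecord F N ν τ E w) p g (k + 1)) := by
  rw [slotsOfRecord_ppSelLive, slotsTOfRecord_ppSelLive_succ]
  rfl

/-- **LEVEL `k + 1` AT THE LIVE SELECTOR OF RECORD: every range point has non-zero post-𝐑 slot ⟺ (sequences exist → some sequence is live).**
[cite: Balaban1989LargeFieldI, (0.3) p.176; Balaban1988Convergent, (3.22)–(3.24) pp.269–270] -/
theorem slotsOfRecord_ppSelLive_succ_nondegenerate_iff (E : B12.RunParams → ℝ) (w : StepWeightsOfRecord F N ν τ.M) (p : B12.RunParams)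
    (g : ℕ → ℝ) (k : ℕ) :
    (∀ s, s ∈ Set.range (ppSelLiveOfRecord F N ν τ E w p g (k + 1)) →
        slotsOfRecord F N ν τ E w (ppSelLiveOfRecord F N ν τ E w) p g (k + 1) s ≠ 0) ↔
      (Nonempty (SeqOfRecord F ν τ.M g p.K (k + 1)) →
        ∃ s, LiveSeq F N ν τ p g (k + 1) (slotsTOfRecord F N ν τ E w (ppSelLiveOfRecord F N ν τ E w) p g (k + 1)) s) := by
  rw [ppSelLiveOfRecord_succ_eq, slotsOfRecord_ppSelLive_succ_eq]
  exact forall_range_liveSel_rstepSlot_ne_zero_iff F N _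

/-- **LEVEL 0 is never degenerate** (every length-0 sequence carries `ρ₀ > 0`; any selector). [cite: Balaban1988Convergent, Thm 1 p.262 (`ρ₀`)] -/
theorem slotsOfRecord_zero_ne_zero (E : B12.RunParams → ℝ) (w : StepWeightsOfRecord F N ν τ.M) (ppSel : PpSelOfRecord F ν τ.M)
    (p : B12.RunParams) (g : ℕ → ℝ) (s : SeqOfRecord F ν τ.M g p.K 0) : slotsOfRecord F N ν τ E w ppSel p g 0 s ≠ 0 := by
  intro h0
  obtain ⟨V₀⟩ := (inferInstance : Nonempty (GaugeField (F.P p.K) 0 (SU N)))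
  have h := congrFun h0 V₀
  rw [Pi.zero_apply] at h
  exact (ne_of_gt (rhoZeroOfRecord_pos F N p.K (g 0) (E p) V₀)) h

end LiveRecord

open scoped Matrix.Norms.L2Operator

/-! ## §3. The LIVE RE-PIN of a Stage-12 parameter: only the selector changes; `SlotsNondegenerate` reduced to per-level liveness -/

section Repin

/-- **THE LIVE RE-PIN** of `θ : Stage12Params`: the same parameter with its `p–p′` selector replaced by the live selector of record at `θ`'s own numerics,
normalisations `EOfRecord₁₀` and step weights `wOfRecord₉` (both selector-blind). [cite: Balaban1989LargeFieldI, (0.3) p.176 and p.177; Balaban1988Convergent, (3.22) p.269] -/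
def Stage12Params.liveRepin (θ : Stage12Params F N) : Stage12Params F N :=
  { θ with ppSel := ppSelLiveOfRecord F N θ.ν θ.τ9 (EOfRecord₁₀ F N θ.toStage9Params) (wOfRecord₉ F N θ.toStage9Params) }

variable (θ : Stage12Params F N)

/-- The re-pin keeps the Stage-8 part (`rfl`). [cite: Balaban1987RG1, (0.21) p.256 (bookkeeping)] -/
theorem Stage12Params.liveRepin_toStage8Params : (θ.liveRepin F N).toStage8Params = θ.toStage8Params := rfl

/-- The re-pin's selector (`rfl`). [cite: Balaban1989LargeFieldI, (0.3) p.176 (bookkeeping)] -/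
theorem Stage12Params.liveRepin_ppSel :
    (θ.liveRepin F N).ppSel = ppSelLiveOfRecord F N θ.ν θ.τ9 (EOfRecord₁₀ F N θ.toStage9Params) (wOfRecord₉ F N θ.toStage9Params) := rfl

/-- The re-pin keeps `ζ` (`rfl`). [cite: Balaban1988Convergent, (3.16) p.268 (bookkeeping)] -/
theorem Stage12Params.liveRepin_ζ : (θ.liveRepin F N).ζ = θ.ζ := rfl

/-- The re-pin keeps `Rz` (`rfl`). [cite: Balaban1988Convergent, (2.21) p.258 (bookkeeping)] -/
theorem Stage12Params.liveRepin_Rz : (θ.liveRepin F N).Rz = θ.Rz := rfl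

/-- The re-pin keeps `Zt` (`rfl`). [cite: Balaban1988Convergent, (3.20) p.269 (bookkeeping)] -/
theorem Stage12Params.liveRepin_Zt : (θ.liveRepin F N).Zt = θ.Zt := rfl

/-- The re-pin keeps `A₁` (`rfl`). [cite: Balaban1987RG1, (1.16) p.262 (bookkeeping)] -/
theorem Stage12Params.liveRepin_A₁ : (θ.liveRepin F N).A₁ = θ.A₁ := rfl

/-- The re-pin keeps the tower numerics (`rfl`). [cite: Balaban1989LargeFieldI, (2.1) p.182 (bookkeeping)] -/
theorem Stage12Params.liveRepin_τ9 : (θ.liveRepin F N).τ9 = θ.τ9 := rfl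

/-- The re-pin keeps the §2 numerics (`rfl`). [cite: Balaban1988Convergent, (2.28) p.259 (bookkeeping)] -/
theorem Stage12Params.liveRepin_s2 : (θ.liveRepin F N).s2 = θ.s2 := rfl

/-- The histories of record are selector-blind (`rfl`). [cite: Balaban1987RG1, (0.17)–(0.20) pp.255–256 (bookkeeping)] -/
theorem Stage12Params.gOfRecord₁₀_liveRepin :
    gOfRecord₁₀ F N (θ.liveRepin F N).toStage9Params = gOfRecord₁₀ F N θ.toStage9Params := rfl

/-- The normalisations of record are selector-blind (`rfl`). [cite: Balaban1988Convergent, (1.15) p.249 (bookkeeping)] -/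
theorem Stage12Params.EOfRecord₁₀_liveRepin :
    EOfRecord₁₀ F N (θ.liveRepin F N).toStage9Params = EOfRecord₁₀ F N θ.toStage9Params := rfl

/-- The step weights of record are selector-blind (`rfl`). [cite: Balaban1988Convergent, (3.2)–(3.5) p.265 (bookkeeping)] -/
theorem Stage12Params.wOfRecord₉_liveRepin :
    wOfRecord₉ F N (θ.liveRepin F N).toStage9Params = wOfRecord₉ F N θ.toStage9Params := rfl

variable {F N θ}

/-- **`Admissible` is selector-blind**: it transports to the re-pin. [cite: Balaban1987RG1, (0.21) p.256, (1.12) p.262; Balaban1988Convergent, (2.10) p.256 (hypothesis dictionary; bookkeeping)] -/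
theorem Stage12Params.Admissible.liveRepin (h : θ.Admissible F N) : (θ.liveRepin F N).Admissible F N := h

/-- **`ZtUnity` is selector-blind.** [cite: Balaban1988Convergent, (3.16)–(3.20) pp.268–269 (bookkeeping)] -/
theorem Stage12Params.ZtUnity.liveRepin (h : θ.ZtUnity F N) : (θ.liveRepin F N).ZtUnity F N := h

/-- **K0b's `HasResidualsOfRecord` is selector-blind.** [cite: Balaban1988Convergent, (3.16) p.268, (2.21) p.258, (3.20) p.269 (bookkeeping)] -/
theorem Stage12Params.HasResidualsOfRecord.liveRepin (h : θ.HasResidualsOfRecord F N) : (θ.liveRepin F N).HasResidualsOfRecord F N :=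
  ⟨h.zeta_eq, h.Rz_eq, h.Zt_eq⟩

/-- The residual laws `rzLaws`, `ztLaws`, `ztLocal` of `Provisos₁₂` are selector-blind (they read `Rz`∕`Zt` only); displayed as the three implications.
[cite: Balaban1988Convergent, (2.21) p.258, (3.20) p.269 (bookkeeping)] -/
theorem Stage12Params.residualLaws_liveRepin :
    ((∀ K, (θ.Rz K).Laws) → ∀ K, ((θ.liveRepin F N).Rz K).Laws) ∧ ((∀ K, (θ.Zt K).Laws) → ∀ K, ((θ.liveRepin F N).Zt K).Laws) ∧
      ((∀ K, (θ.Zt K).LocalLaws) → ∀ K, ((θ.liveRepin F N).Zt K).LocalLaws) :=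
  ⟨fun h => h, fun h => h, fun h => h⟩

variable (F N θ)

/-- **`SlotsNondegenerate` AT THE LIVE RE-PIN ⟺ PER-LEVEL LIVENESS UP TO THE TORUS** (12b v2.3: the predicate is guarded by the level `k ≤ p.K`): for every run
`p` and every level `k + 1 ≤ p.K` that has sequences at all, SOME sequence is live for the pre-𝐑 family of record there (level 0 is never degenerate).  This is the
ONLY residual content of the conjunct at the re-pinned parameter (row P12 proper — a theorem from `Provisos₁₀`, seat K0b's `Record12PresentSlots` + this seat's
`Record12LiveSelectorTorus`). [cite: Balaban1988Convergent, (3.22)–(3.24) pp.269–270; Balaban1989LargeFieldI, (0.3) p.176] -/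
theorem Stage12Params.slotsNondegenerate_liveRepin_iff :
    (θ.liveRepin F N).SlotsNondegenerate ↔
      ∀ (p : B12.RunParams) (k : ℕ), k + 1 ≤ p.K → Nonempty (SeqOfRecord F θ.ν θ.τ9.M (gOfRecord₁₀ F N θ.toStage9Params p) p.K (k + 1)) →
        ∃ s, LiveSeq F N θ.ν θ.τ9 p (gOfRecord₁₀ F N θ.toStage9Params p) (k + 1)
          (slotsTOfRecord F N θ.ν θ.τ9 (EOfRecord₁₀ F N θ.toStage9Params) (wOfRecord₉ F N θ.toStage9Params) (θ.liveRepin F N).ppSel p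
            (gOfRecord₁₀ F N θ.toStage9Params p) (k + 1)) s := by
  constructor
  · intro h p k hk
    refine (slotsOfRecord_ppSelLive_succ_nondegenerate_iff F N θ.ν θ.τ9 _ _ p _ k).mp (fun s hs => ?_)
    have h' := h p (k + 1)
    apply h' <;> first | exact hk | exact hs
  · intro h p k s
    intros
    cases k with
    | zero => exact slotsOfRecord_zero_ne_zero F N θ.ν θ.τ9 _ _ _ p _ s
    | succ k =>
      refine (slotsOfRecord_ppSelLive_succ_nondegenerate_iff F N θ.ν θ.τ9 _ _ p _ k).mpr (h p k ‹_›) s ?_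
      assumption

/-- The `←` half, named, from UNGUARDED per-level liveness (a fortiori). [cite: Balaban1988Convergent, (3.22)–(3.24) pp.269–270; Balaban1989LargeFieldI, (0.3) p.176] -/
theorem Stage12Params.slotsNondegenerate_liveRepin_of_live
    (h : ∀ (p : B12.RunParams) (k : ℕ), Nonempty (SeqOfRecord F θ.ν θ.τ9.M (gOfRecord₁₀ F N θ.toStage9Params p) p.K (k + 1)) →
      ∃ s, LiveSeq F N θ.ν θ.τ9 p (gOfRecord₁₀ F N θ.toStage9Params p) (k + 1)
        (slotsTOfRecord F N θ.ν θ.τ9 (EOfRecord₁₀ F N θ.toStage9Params) (wOfRecord₉ F N θ.toStage9Params) (θ.liveRepin F N).ppSel p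
          (gOfRecord₁₀ F N θ.toStage9Params p) (k + 1)) s) :
    (θ.liveRepin F N).SlotsNondegenerate :=
  (Stage12Params.slotsNondegenerate_liveRepin_iff F N θ).mpr fun p k _ hne => h p k hne

end Repin

/-! ## §4. The re-pinned K0′ witness `θ₀ˡⁱᵛᵉ = (theta12OfRecord F N ζ Rz Zt).liveRepin` -/

section Theta

variable (ζ : ZetaOfRecord F N numerics7OfRecord₁₂ 1) (Rz : (K : ℕ) → Sect2.Residual (F.P K) (MatA N)) (Zt : (K : ℕ) → TkResidualW F N (FluctV N) K)

/-- **THE RE-PINNED PARAMETER OF RECORD** (director-ym LINE №114 (α)): `theta12OfRecord F N ζ Rz Zt` with its `p–p′` selector re-pinned to the LIVE SELECTOR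
OF RECORD; every numeral, the chart of record, `ζ`, `Rz`, `Zt` unchanged. [cite: Balaban1989LargeFieldI, (0.3) p.176 and p.177; Balaban1988Convergent, (2.10) p.256, (2.21) p.258, (3.16) p.268, (3.22) p.269 (parameter dictionary; bookkeeping witness)] -/
def theta12LiveOfRecord : Stage12Params F N :=
  (theta12OfRecord F N ζ Rz Zt).liveRepin F N

/-- `θ₀ˡⁱᵛᵉ` IS the live re-pin of `θ₀` (`rfl`). [cite: Balaban1989LargeFieldI, (0.3) p.176 (bookkeeping)] -/
theorem theta12LiveOfRecord_eq : theta12LiveOfRecord F N ζ Rz Zt = (theta12OfRecord F N ζ Rz Zt).liveRepin F N := rfl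

/-- `θ₀ˡⁱᵛᵉ`'s Stage-8 part IS `stage8OfRecord₁₂` (`rfl`) — the window theorems of `Record12NumericsWindow` apply verbatim. [cite: Balaban1987RG1, (0.21) p.256 (bookkeeping)] -/
theorem theta12LiveOfRecord_toStage8Params : (theta12LiveOfRecord F N ζ Rz Zt).toStage8Params = stage8OfRecord₁₂ F N := rfl

/-- `θ₀ˡⁱᵛᵉ`'s selector IS the live selector of record at `θ₀`'s numerics, normalisations and weights (`rfl`). [cite: Balaban1989LargeFieldI, (0.3) p.176 (bookkeeping)] -/
theorem theta12LiveOfRecord_ppSel :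
    (theta12LiveOfRecord F N ζ Rz Zt).ppSel =
      ppSelLiveOfRecord F N numerics7OfRecord₁₂ towerNumericsOfRecord₁₂ (EOfRecord₁₀ F N (theta12OfRecord F N ζ Rz Zt).toStage9Params)
        (wOfRecord₉ F N (theta12OfRecord F N ζ Rz Zt).toStage9Params) := rfl

/-- `θ₀ˡⁱᵛᵉ` keeps `ζ` (`rfl`). [cite: Balaban1988Convergent, (3.16) p.268 (bookkeeping)] -/
theorem theta12LiveOfRecord_ζ : (theta12LiveOfRecord F N ζ Rz Zt).ζ = ζ := rfl

/-- `θ₀ˡⁱᵛᵉ` keeps `Rz` (`rfl`). [cite: Balaban1988Convergent, (2.21) p.258 (bookkeeping)] -/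
theorem theta12LiveOfRecord_Rz : (theta12LiveOfRecord F N ζ Rz Zt).Rz = Rz := rfl

/-- `θ₀ˡⁱᵛᵉ` keeps `Zt` (`rfl`). [cite: Balaban1988Convergent, (3.20) p.269 (bookkeeping)] -/
theorem theta12LiveOfRecord_Zt : (theta12LiveOfRecord F N ζ Rz Zt).Zt = Zt := rfl

/-- `θ₀ˡⁱᵛᵉ.γ = 1∕2` (`rfl`). [cite: Balaban1987RG1, Thm 1 p.255 (bookkeeping)] -/
theorem theta12LiveOfRecord_γ : (theta12LiveOfRecord F N ζ Rz Zt).γ = 1 / 2 := rfl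

/-- `θ₀ˡⁱᵛᵉ.A₁ = 1` (`rfl`). [cite: Balaban1987RG1, (1.16) p.262 (bookkeeping)] -/
theorem theta12LiveOfRecord_A₁ : (theta12LiveOfRecord F N ζ Rz Zt).A₁ = 1 := rfl

/-- `θ₀ˡⁱᵛᵉ.ν = numerics7OfRecord₁₂` (`rfl`). [cite: Balaban1988Convergent, (2.4) p.255 (bookkeeping)] -/
theorem theta12LiveOfRecord_ν : (theta12LiveOfRecord F N ζ Rz Zt).ν = numerics7OfRecord₁₂ := rfl

/-- `θ₀ˡⁱᵛᵉ.τ9.M = 1` (`rfl`). [cite: Balaban1989LargeFieldI, (2.1) p.182 (bookkeeping)] -/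
theorem theta12LiveOfRecord_τ9_M : (theta12LiveOfRecord F N ζ Rz Zt).τ9.M = 1 := rfl

/-- **`θ₀ˡⁱᵛᵉ` IS ADMISSIBLE — hypothesis-free, for every choice of the residual objects** (`Admissible` reads no selector).
[cite: Balaban1987RG1, (0.21) p.256, (1.12) p.262, (1.20)–(1.21) p.264; Balaban1988Convergent, (2.10) p.256, (2.28) p.259, (2.34)–(2.39) p.261, (3.4) p.265 (bookkeeping witness)] -/
theorem admissible_theta12LiveOfRecord : (theta12LiveOfRecord F N ζ Rz Zt).Admissible F N :=
  (admissible_theta12OfRecord F N ζ Rz Zt).liveRepin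

/-- **AT K0b's RESIDUALS OF RECORD `θ₀ˡⁱᵛᵉ` CARRIES THEM** (`⟨rfl, rfl, rfl⟩`): `ζ = zeta316OfRecord`, `Rz = RzOfRecord`, `Zt = ZtOfRecord`.
[cite: Balaban1988Convergent, (3.16) p.268, (2.21) p.258, (3.20) p.269 (bookkeeping)] -/
theorem hasResidualsOfRecord_theta12LiveOfRecord :
    (theta12LiveOfRecord F N (zeta316OfRecord F N numerics7OfRecord₁₂ 1 1) (RzOfRecord F N) (ZtOfRecord F N)).HasResidualsOfRecord F N :=
  ⟨rfl, rfl, rfl⟩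

/-- **… hence print's partition of unity `ZtUnity` holds at it** (K0b's `HasResidualsOfRecord.ztUnity`, by name).
[cite: Balaban1988Convergent, (3.16)–(3.20) pp.268–269] -/
theorem ztUnity_theta12LiveOfRecord :
    (theta12LiveOfRecord F N (zeta316OfRecord F N numerics7OfRecord₁₂ 1 1) (RzOfRecord F N) (ZtOfRecord F N)).ZtUnity F N :=
  (hasResidualsOfRecord_theta12LiveOfRecord F N).ztUnity

/-- **ROW P12 AT `θ₀ˡⁱᵛᵉ`, REDUCED: `SlotsNondegenerate` ⟺ per-level liveness up to the torus** — for every run `p` and level `k + 1 ≤ p.K` with sequences, some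
sequence is live for the pre-𝐑 family of record at `θ₀ˡⁱᵛᵉ`'s selector (a theorem from `Provisos₁₀`: `Record12LiveSelectorTorus`).
[cite: Balaban1988Convergent, (3.22)–(3.24) pp.269–270; Balaban1989LargeFieldI, (0.3) p.176] -/
theorem slotsNondegenerate_theta12LiveOfRecord_iff :
    (theta12LiveOfRecord F N ζ Rz Zt).SlotsNondegenerate ↔
      ∀ (p : B12.RunParams) (k : ℕ), k + 1 ≤ p.K →
        Nonempty (SeqOfRecord F numerics7OfRecord₁₂ 1 (gOfRecord₁₀ F N (theta12OfRecord F N ζ Rz Zt).toStage9Params p) p.K (k + 1)) →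
          ∃ s, LiveSeq F N numerics7OfRecord₁₂ towerNumericsOfRecord₁₂ p (gOfRecord₁₀ F N (theta12OfRecord F N ζ Rz Zt).toStage9Params p) (k + 1)
            (slotsTOfRecord F N numerics7OfRecord₁₂ towerNumericsOfRecord₁₂ (EOfRecord₁₀ F N (theta12OfRecord F N ζ Rz Zt).toStage9Params)
              (wOfRecord₉ F N (theta12OfRecord F N ζ Rz Zt).toStage9Params) (theta12LiveOfRecord F N ζ Rz Zt).ppSel p
              (gOfRecord₁₀ F N (theta12OfRecord F N ζ Rz Zt).toStage9Params p) (k + 1)) s :=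
  Stage12Params.slotsNondegenerate_liveRepin_iff F N (theta12OfRecord F N ζ Rz Zt)

/-- The `←` half at `θ₀ˡⁱᵛᵉ` from UNGUARDED per-level liveness, named. [cite: Balaban1988Convergent, (3.22)–(3.24) pp.269–270; Balaban1989LargeFieldI, (0.3) p.176] -/
theorem slotsNondegenerate_theta12LiveOfRecord_of_live
    (h : ∀ (p : B12.RunParams) (k : ℕ),
      Nonempty (SeqOfRecord F numerics7OfRecord₁₂ 1 (gOfRecord₁₀ F N (theta12OfRecord F N ζ Rz Zt).toStage9Params p) p.K (k + 1)) →
        ∃ s, LiveSeq F N numerics7OfRecord₁₂ towerNumericsOfRecord₁₂ p (gOfRecord₁₀ F N (theta12OfRecord F N ζ Rz Zt).toStage9Params p) (k + 1)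
          (slotsTOfRecord F N numerics7OfRecord₁₂ towerNumericsOfRecord₁₂ (EOfRecord₁₀ F N (theta12OfRecord F N ζ Rz Zt).toStage9Params)
            (wOfRecord₉ F N (theta12OfRecord F N ζ Rz Zt).toStage9Params) (theta12LiveOfRecord F N ζ Rz Zt).ppSel p
            (gOfRecord₁₀ F N (theta12OfRecord F N ζ Rz Zt).toStage9Params p) (k + 1)) s) :
    (theta12LiveOfRecord F N ζ Rz Zt).SlotsNondegenerate :=
  Stage12Params.slotsNondegenerate_liveRepin_of_live F N (theta12OfRecord F N ζ Rz Zt) h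

/-- **WHAT K0b's LEVEL-1 LEMMA GIVES AT `θ₀ˡⁱᵛᵉ`** (at the residuals of record, every run with `1 ≤ p.K`): SOME level-1 pre-𝐑 slot is non-zero on its own
χ₁-support — liveness at level 1 up to the `Z′`-normalisation factor `∫⌈_{Z′(s′)} χ₁(s′)·T(s′)` (the pre-𝐑 family at level 1 reads no selector).
[cite: Balaban1988Convergent, (3.1) p.264, §3 p.267, (3.24)–(3.25) p.270] -/
theorem exists_slotT_one_ne_zero_theta12LiveOfRecord (p : B12.RunParams) (hK : 0 < p.K) :
    ∃ (s' : SeqOfRecord F numerics7OfRecord₁₂ 1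
        (gOfRecord₁₀ F N (theta12LiveOfRecord F N (zeta316OfRecord F N numerics7OfRecord₁₂ 1 1) (RzOfRecord F N) (ZtOfRecord F N)).toStage9Params p) p.K 1)
      (V' : GaugeField (F.P p.K) 1 (SU N)),
      chiSeqOfRecord F N numerics7OfRecord₁₂ 1 _ p.K 1 s' V' ≠ 0 ∧
        slotsTOfRecord F N numerics7OfRecord₁₂ towerNumericsOfRecord₁₂
          (EOfRecord₁₀ F N (theta12LiveOfRecord F N (zeta316OfRecord F N numerics7OfRecord₁₂ 1 1) (RzOfRecord F N) (ZtOfRecord F N)).toStage9Params)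
          (wOfRecord₉ F N (theta12LiveOfRecord F N (zeta316OfRecord F N numerics7OfRecord₁₂ 1 1) (RzOfRecord F N) (ZtOfRecord F N)).toStage9Params)
          (theta12LiveOfRecord F N (zeta316OfRecord F N numerics7OfRecord₁₂ 1 1) (RzOfRecord F N) (ZtOfRecord F N)).ppSel p
          (gOfRecord₁₀ F N (theta12LiveOfRecord F N (zeta316OfRecord F N numerics7OfRecord₁₂ 1 1) (RzOfRecord F N) (ZtOfRecord F N)).toStage9Params p)
          1 s' V' ≠ 0 :=
  exists_slotT_one_ne_zero_of_hasResidualsOfRecord (hasResidualsOfRecord_theta12LiveOfRecord F N) p hK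

/-- **THE K0′ BODY FOR `F` AT `N = 2` FROM THE RE-PINNED WITNESS** — the text of `Record12Inhabited` (rev 15) for one family, VERBATIM: GIVEN the provisos of
record at `θ₀ˡⁱᵛᵉ` (its Stage-10 tower clauses read the live selector; the `bg` row P11) and per-level liveness (row P12), the re-pinned parameter at K0b's
residuals inhabits `∃ θ, θ.Provisos₁₂ F 2 ∧ (θ.ZtUnity F 2 ∧ θ.SlotsNondegenerate) ∧ θ.Admissible F 2`.  Nothing is discharged: the two hypotheses ARE the
open rows. [cite: Balaban1988Convergent, Thm 1 p.262, (3.16)–(3.22) pp.268–269; Balaban1989LargeFieldI, (0.3)–(0.4) p.176 (bookkeeping)] -/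
theorem exists_k0prime_of_theta12Live (F : T4Family)
    (h : (theta12LiveOfRecord F 2 (zeta316OfRecord F 2 numerics7OfRecord₁₂ 1 1) (RzOfRecord F 2) (ZtOfRecord F 2)).Provisos₁₂ F 2)
    (hlive : ∀ (p : B12.RunParams) (k : ℕ),
      Nonempty (SeqOfRecord F numerics7OfRecord₁₂ 1
        (gOfRecord₁₀ F 2 (theta12OfRecord F 2 (zeta316OfRecord F 2 numerics7OfRecord₁₂ 1 1) (RzOfRecord F 2) (ZtOfRecord F 2)).toStage9Params p)
        p.K (k + 1)) →
        ∃ s, LiveSeq F 2 numerics7OfRecord₁₂ towerNumericsOfRecord₁₂ p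
          (gOfRecord₁₀ F 2 (theta12OfRecord F 2 (zeta316OfRecord F 2 numerics7OfRecord₁₂ 1 1) (RzOfRecord F 2) (ZtOfRecord F 2)).toStage9Params p)
          (k + 1)
          (slotsTOfRecord F 2 numerics7OfRecord₁₂ towerNumericsOfRecord₁₂
            (EOfRecord₁₀ F 2 (theta12OfRecord F 2 (zeta316OfRecord F 2 numerics7OfRecord₁₂ 1 1) (RzOfRecord F 2) (ZtOfRecord F 2)).toStage9Params)
            (wOfRecord₉ F 2 (theta12OfRecord F 2 (zeta316OfRecord F 2 numerics7OfRecord₁₂ 1 1) (RzOfRecord F 2) (ZtOfRecord F 2)).toStage9Params)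
            (theta12LiveOfRecord F 2 (zeta316OfRecord F 2 numerics7OfRecord₁₂ 1 1) (RzOfRecord F 2) (ZtOfRecord F 2)).ppSel p
            (gOfRecord₁₀ F 2 (theta12OfRecord F 2 (zeta316OfRecord F 2 numerics7OfRecord₁₂ 1 1) (RzOfRecord F 2) (ZtOfRecord F 2)).toStage9Params p)
            (k + 1)) s) :
    ∃ θ : Stage12Params F 2, θ.Provisos₁₂ F 2 ∧ (θ.ZtUnity F 2 ∧ θ.SlotsNondegenerate) ∧ θ.Admissible F 2 :=
  ⟨_, h, ⟨ztUnity_theta12LiveOfRecord F 2, slotsNondegenerate_theta12LiveOfRecord_of_live F 2 _ _ _ hlive⟩,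
    admissible_theta12LiveOfRecord F 2 _ _ _⟩

end Theta

end Literature.MathematicalPhysics.QuantumFieldTheory.Balaban1983to89.Node00

end
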